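import Literature.Geometry.Lorentzian.ChartMetricCompactness
import HarnessLib

/-!
# Route ClusterCompleteness · crux `OmegaLimitMultiKerr` — `Cᵏ_loc` ω-limits of the late-time
# translates of one field (the "tame ⇒ ω-limit points exist" half of the LaSalle dictionary)

Structure lemma for the crux stmt-FinalStateConjecture-14664 (`ClusterCompleteness.OmegaLimitMultiKerr`,
rank 9), line `Sketch`, lead gen 3. The recommended re-line of the crux (leads 0/c1/c2,
`Cruxes/OmegaLimitMultiKerr/Lines/Sketch.md`; ideator 1's card `lasalle-lands-on-liminf`) reads the
recur-disjunct `Recurs k 𝒟` as "the reference multi-Kerr configuration is an ω-LIMIT POINT of the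
late-time translates of the charted geometry", and its first pointwise step is COMPACTNESS: era charts
with all-time `C^{k+1}` bounds have `Cᵏ_loc`-convergent subsequences of translates. This file proves
that step in the abstract form every chart consumes:

**Theorem (`exists_strictMono_tendsto_supCkENorm_translate_sub`).** Let `O ⊆ E` be open and
forward-invariant under the translations `x ↦ x + s • w`, `s ≥ 0`; let `h : E → W` be `C^{k+1}` on
`O` (e.g. the deviation `Ψ^* g − g₀` of a late chart, extended by zero), and `T n ≥ 0` a sequence of
times such that on every compact `K ⊆ O` the derivatives of order `≤ k + 1` of the translates
`h (· + T n • w)` are bounded uniformly for all large `n` (all-time `C^{k+1}` bounds on the late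
region give this for EVERY `T n → ∞`). Then along a subsequence `φ` the translates converge in `Cᵏ`
on every compact subset of `O` to a `Cᵏ` field `g` on `O`:
`supCkENorm K k (h (· + T (φ n) • w) − g) → 0`.

It is the `Cᵏ` Arzelà–Ascoli theorem of the tree (`Literature/Analysis/Calculus/CkArzelaAscoli.lean`,
in the `supCkENorm` form `exists_strictMono_tendsto_supCkENorm_sub` of
`Literature/Geometry/Lorentzian/ChartMetricCompactness.lean`) applied to the sequence of translates;
the only work is the bookkeeping that translation commutes with `iteratedFDeriv`
(`iteratedFDeriv_comp_add_right`) and that the finitely many early translates are bounded on compacts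
by continuity. Petersen 2006, Ch. 10, §3.1; Hale 1980, Ch. I, §8 (ω-limit sets of bounded orbits are
nonempty).
-/

-- every `Summit.FinalStateConjecture.FinalStateConjecture.…` name repeats the summit = sub-problem segment (D-0017 layout)
set_option linter.dupNamespace false

noncomputable section

open Set Filter Topology Function
open scoped ContDiff Topology ENNReal

namespace Summit.FinalStateConjecture.FinalStateConjecture.Theorems.ClusterCompleteness

open Literature.Geometry.Lorentzian

/-- **`Cᵏ_loc` ω-limits of late-time translates exist under eventual uniform `C^{k+1}` bounds.**
For `h` of class `C^{k+1}` on an open set `O` forward-invariant under `x ↦ x + s • w` (`s ≥ 0`) and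
nonnegative times `T n` such that on each compact `K ⊆ O` the derivatives of order `≤ k + 1` of the
translates `h (· + T n • w)` are bounded uniformly in all large `n`, a subsequence of translates
converges in `Cᵏ` on every compact subset of `O` to a `Cᵏ` field on `O`
(`Cᵏ` Arzelà–Ascoli, Petersen 2006, Ch. 10, §3.1, applied to the translates; Hale 1980, Ch. I, §8:
ω-limit sets of precompact orbits are nonempty). Stated in closed form (registered structure stub of
the crux stmt-FinalStateConjecture-14664). [cite: Petersen2006, Ch. 10 §3.1] -/
theorem exists_strictMono_tendsto_supCkENorm_translate_sub :
    ∀ {E : Type*} [NormedAddCommGroup E] [NormedSpace ℝ E] [FiniteDimensional ℝ E]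
      {W : Type*} [NormedAddCommGroup W] [NormedSpace ℝ W] [FiniteDimensional ℝ W] {O : Set E},
      IsOpen O → ∀ {w : E}, (∀ x ∈ O, ∀ s : ℝ, 0 ≤ s → x + s • w ∈ O) →
      ∀ {k : ℕ} {h : E → W}, ContDiffOn ℝ (k + 1) h O → ∀ {T : ℕ → ℝ}, (∀ n, 0 ≤ T n) →
      (∀ K ⊆ O, IsCompact K → ∃ Λ : ℝ, ∀ᶠ n in atTop, ∀ i, i ≤ k + 1 → ∀ z ∈ K,
        ‖iteratedFDeriv ℝ i h (z + T n • w)‖ ≤ Λ) →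
      ∃ (g : E → W) (φ : ℕ → ℕ), StrictMono φ ∧ ContDiffOn ℝ k g O ∧
        ∀ K ⊆ O, IsCompact K →
          Tendsto (fun n ↦ supCkENorm K k (fun x ↦ h (x + T (φ n) • w) - g x)) atTop (𝓝 0) := by
  intro E _ _ _ W _ _ _ O hO w hOw k h hh T hT hb
  -- the translates
  set G : ℕ → E → W := fun n x ↦ h (x + T n • w) with hGdef
  have hmaps : ∀ n, MapsTo (fun x : E ↦ x + T n • w) O O := fun n x hx ↦ hOw x hx _ (hT n)
  have hG : ∀ n, ContDiffOn ℝ (k + 1) (G n) O := fun n ↦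
    hh.comp ((contDiff_id.add contDiff_const).contDiffOn) (hmaps n)
  have hiter : ∀ n i z, iteratedFDeriv ℝ i (G n) z = iteratedFDeriv ℝ i h (z + T n • w) :=
    fun n i z ↦ iteratedFDeriv_comp_add_right i (T n • w) z
  -- continuity of the derivatives of `h` of order `≤ k + 1` on `O`
  have hcont : ∀ i, i ≤ k + 1 → ContinuousOn (iteratedFDeriv ℝ i h) O := by
    intro i hi
    have h1 : ContinuousOn (iteratedFDerivWithin ℝ i h O) O :=
      hh.continuousOn_iteratedFDerivWithin (by exact_mod_cast hi) hO.uniqueDiffOn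
    exact h1.congr fun x hx ↦ (iteratedFDerivWithin_of_isOpen i hO hx).symm
  -- common bounds on compacts for ALL `n`
  have hb' : ∀ K ⊆ O, IsCompact K →
      ∃ Λ : ℝ, ∀ n, ∀ i, i ≤ k + 1 → ∀ z ∈ K, ‖iteratedFDeriv ℝ i (G n) z‖ ≤ Λ := by
    intro K hKO hK
    obtain ⟨Λ₀, hΛ₀⟩ := hb K hKO hK
    obtain ⟨N, hN⟩ := eventually_atTop.1 hΛ₀
    -- each early translate is bounded on `K` by continuity
    have hsingle : ∀ n i, i ≤ k + 1 → ∃ C : ℝ, ∀ z ∈ K, ‖iteratedFDeriv ℝ i (G n) z‖ ≤ C := by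
      intro n i hi
      have hKn : IsCompact ((fun x : E ↦ x + T n • w) '' K) :=
        hK.image (continuous_id.add continuous_const)
      have hKnO : (fun x : E ↦ x + T n • w) '' K ⊆ O := by
        rintro _ ⟨x, hx, rfl⟩
        exact hmaps n (hKO hx)
      obtain ⟨C, hC⟩ := hKn.exists_bound_of_continuousOn ((hcont i hi).mono hKnO)
      refine ⟨C, fun z hz ↦ ?_⟩
      rw [hiter]
      exact hC _ (mem_image_of_mem _ hz)
    choose! C hC using hsingle
    refine ⟨max Λ₀ (∑ n ∈ Finset.range N, ∑ i ∈ Finset.range (k + 2), |C n i|), ?_⟩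
    intro n i hi z hz
    rcases le_or_gt N n with hn | hn
    · rw [hiter]
      exact (hN n hn i hi z hz).trans (le_max_left _ _)
    · refine le_trans ?_ (le_max_right _ _)
      have hi' : i ∈ Finset.range (k + 2) := Finset.mem_range.2 (by omega)
      have hn' : n ∈ Finset.range N := Finset.mem_range.2 hn
      calc ‖iteratedFDeriv ℝ i (G n) z‖ ≤ C n i := hC n i hi z hz
        _ ≤ |C n i| := le_abs_self _
        _ ≤ ∑ j ∈ Finset.range (k + 2), |C n j| :=
            Finset.single_le_sum (f := fun j ↦ |C n j|) (fun _ _ ↦ abs_nonneg _) hi'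
        _ ≤ ∑ m ∈ Finset.range N, ∑ j ∈ Finset.range (k + 2), |C m j| :=
            Finset.single_le_sum (f := fun m ↦ ∑ j ∈ Finset.range (k + 2), |C m j|)
              (fun _ _ ↦ Finset.sum_nonneg fun _ _ ↦ abs_nonneg _) hn'
  obtain ⟨g, φ, hφ, hgk, hlim⟩ := exists_strictMono_tendsto_supCkENorm_sub hO hG hb'
  exact ⟨g, φ, hφ, hgk, fun K hKO hK ↦ hlim K hKO hK⟩

end Summit.FinalStateConjecture.FinalStateConjecture.Theorems.ClusterCompleteness

end
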